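import Summits.CriticalPhenomena.PercolationContinuityZ3.Theorems.PercNearOneGluingNoHeavyPcintNawGrowth
import Summits.CriticalPhenomena.PercolationContinuityZ3.Theorems.PercNearOneGluingNoHeavyPcintNawMemoryFour
import Literature.Probability.RandomPlanarGeometry.SAWDimensionGapBounds
import HarnessLib

/-!
# CriticalPhenomena/PercolationContinuityZ3 — Theorems/PercNearOneGluingNoHeavyPcintNawGrowthBounds.lean:
# closed-form bounds on the neighbour-avoiding connective constant: `d ≤ μ_NAW(ℤ^d) ≤ (d−1) + √((d−1)²+1)`, and `μ_NAW(ℤ²) < μ(ℤ²)`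

Lane prim-pcint, seat prim-pcint-2 (gen 15), STRUCTURE rule — companion of …PcintNawGrowth (`NawTail.nawConst = μ_NAW`).  HONEST
FRAMING: elementary; turns the tree's memory-4 neighbour-avoiding count bound (`card_nawFourWords_le_geometric`, …PcintNawMemoryFour:
`N_{n+2} ≤ 4d² λ_d^{n+1}`, `λ_d = (d−1) + √((d−1)²+1)` the Perron root of the two-class recursion) into a bound on the CONSTANT, and
records the one dimension where the tree's certified SAW lower bound separates the two constants.  Nothing here moves a cell.

* `tendsto_const_rpow_one_div_add_two` — `K^{1/(n+2)} → 1` (`K > 0`);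
* `nawConst_le_of_card_le_geometric` — a geometric count bound `N_{n+2} ≤ K λ^{n+1}` (`K > 0`, `λ > 0`) gives `μ_NAW ≤ λ`;
* **`nawConst_le_nawFourConst`** — `μ_NAW(ℤ^d) ≤ (d−1) + √((d−1)²+1)` for `d ≥ 2` (`d = 3`: `≤ 2 + √5 = 4.2360…`; numerically `μ_NAW(ℤ³) ≈ 4.046`,
  the memory-20 rung is `4.0838`); with `NawTail.le_nawConst`: `d ≤ μ_NAW(ℤ^d) ≤ (d−1) + √((d−1)²+1) < 2d − 1`;
* **`nawConst_two_lt_connectiveConstant_two`** — `μ_NAW(ℤ²) ≤ 1 + √2 < 5/2 ≤ μ(ℤ²)` (`SAW.Zd.nat_add_half_le_connectiveConstant`): on the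
  square lattice the neighbour-avoiding constant is STRICTLY below the self-avoiding one, as a theorem.  (For `d ≥ 3` the tree's
  certified lower bound `d + 1/2 ≤ μ(ℤ^d)` is below `λ_d`, so strictness there is numerical only: 4.046 < 4.684 on `ℤ³`.)

All PROVED (no `sorry`, no named fact).  Written by prim-pcint-2 gen 15 (prover-prim-pcint-2-g15-0), 2026-08-23.
-/

noncomputable section

open Filter Topology
open Literature.Probability.LatticeModels Literature.Probability.Percolation
open Literature.Probability.RandomPlanarGeometry.SAW.Zd (connectiveConstant nat_add_half_le_connectiveConstant)

namespace Summit.CriticalPhenomena.PercolationContinuityZ3.Theorems.Pcint.NawTail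

variable {d : ℕ}

/-- `K^{1/(n+2)} → 1` as `n → ∞` for `K > 0`. [folklore] -/
theorem tendsto_const_rpow_one_div_add_two {K : ℝ} (hK : 0 < K) :
    Tendsto (fun n : ℕ => K ^ (1 / ((n : ℝ) + 2))) atTop (𝓝 1) := by
  have h1 : Tendsto (fun n : ℕ => (n : ℝ) + 2) atTop atTop :=
    tendsto_natCast_atTop_atTop.atTop_add tendsto_const_nhds
  have h2 : Tendsto (fun n : ℕ => Real.log K * (1 / ((n : ℝ) + 2))) atTop (𝓝 (Real.log K * 0)) :=
    (tendsto_const_nhds.div_atTop h1).const_mul _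
  rw [mul_zero] at h2
  have h3 := (Real.continuous_exp.tendsto 0).comp h2
  rw [Real.exp_zero] at h3
  refine h3.congr fun n => ?_
  simp only [Function.comp_apply]
  rw [Real.rpow_def_of_pos hK]

/-- **A geometric count bound bounds the constant**: if `N_{n+2} ≤ K λ^{n+1}` for all `n` (`K > 0`, `λ > 0`) then `μ_NAW(ℤ^d) ≤ λ`
(`μ_NAW ≤ N_{n+2}^{1/(n+2)} ≤ (K/λ)^{1/(n+2)} λ → λ`). [folklore] -/
theorem nawConst_le_of_card_le_geometric {K lam : ℝ} (hK : 0 < K) (hlam : 0 < lam)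
    (h : ∀ n : ℕ, (nawCount d (n + 2) : ℝ) ≤ K * lam ^ (n + 1)) : nawConst d ≤ lam := by
  -- the comparison sequence `g n = (K/λ)^{1/(n+2)} · λ → λ`
  have hg : Tendsto (fun n : ℕ => (K / lam) ^ (1 / ((n : ℝ) + 2)) * lam) atTop (𝓝 lam) := by
    have := (tendsto_const_rpow_one_div_add_two (div_pos hK hlam)).mul_const lam
    rwa [one_mul] at this
  refine ge_of_tendsto hg (Eventually.of_forall fun n => ?_)
  have hn2 : (0 : ℝ) < (n : ℝ) + 2 := by positivity
  -- `μ_NAW ≤ N_{n+2}^{1/(n+2)}`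
  have h1 : nawConst d ≤ (nawCount d (n + 2) : ℝ) ^ (1 / ((n : ℝ) + 2)) := by
    have := nawConst_le_rpow d (n := n + 2) (by omega)
    simpa [Nat.cast_add] using this
  refine h1.trans ?_
  -- `N_{n+2}^{1/(n+2)} ≤ (K λ^{n+1})^{1/(n+2)} = (K/λ)^{1/(n+2)} λ`
  have h2 : (nawCount d (n + 2) : ℝ) ^ (1 / ((n : ℝ) + 2)) ≤ (K * lam ^ (n + 1)) ^ (1 / ((n : ℝ) + 2)) :=
    Real.rpow_le_rpow (Nat.cast_nonneg _) (h n) (by positivity)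
  refine h2.trans (le_of_eq ?_)
  have hKl : K * lam ^ (n + 1) = (K / lam) * lam ^ (n + 2) := by
    field_simp
    ring
  rw [hKl, Real.mul_rpow (div_pos hK hlam).le (by positivity)]
  congr 1
  rw [← Real.rpow_natCast lam (n + 2), ← Real.rpow_mul hlam.le]
  push_cast
  rw [mul_one_div_cancel hn2.ne', Real.rpow_one]

/-- **`μ_NAW(ℤ^d) ≤ (d−1) + √((d−1)²+1)`** for `d ≥ 2`: the memory-4 neighbour-avoiding constant (Perron root of the two-class
recursion `S' ≤ S + T`, `T' ≤ (2d−2)S + (2d−3)T` of …PcintNawMemoryFour) bounds the neighbour-avoiding connective constant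
(`d = 3`: `2 + √5 = 4.2360…`; `d = 2`: `1 + √2`). [folklore] -/
theorem nawConst_le_nawFourConst (hd : 2 ≤ d) :
    nawConst d ≤ (d - 1 : ℝ) + Real.sqrt ((d - 1) ^ 2 + 1) := by
  classical
  have hd' : (2 : ℝ) ≤ d := by exact_mod_cast hd
  set r := Real.sqrt (((d : ℝ) - 1) ^ 2 + 1) with hr
  have hr0 : 0 ≤ r := Real.sqrt_nonneg _
  have hr2 : r ^ 2 = ((d : ℝ) - 1) ^ 2 + 1 := Real.sq_sqrt (by positivity)
  have hr1 : 1 ≤ r := by nlinarith [sq_nonneg (r + 1)]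
  have hlam2 : (2 : ℝ) ≤ (d - 1 : ℝ) + r := by linarith
  have hroot : (2 * d - 2 : ℝ) * ((d - 1 : ℝ) + r) + 1 ≤ ((d - 1 : ℝ) + r) ^ 2 := by nlinarith [hr2]
  refine nawConst_le_of_card_le_geometric (K := 4 * (d : ℝ) ^ 2) (by positivity) (by linarith) fun n => ?_
  have hgeo := card_nawFourWords_le_geometric hd hlam2 hroot n
  have hle : (nawCount d (n + 2) : ℝ) ≤ ((nawFourWords d (n + 2)).card : ℝ) := by
    have h := card_nawWords_le_card_nawFourWords d (n + 2)
    have h' : nawCount d (n + 2) ≤ (nawFourWords d (n + 2)).card := by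
      unfold nawCount nawWords; convert h using 2
    exact_mod_cast h'
  exact hle.trans hgeo

/-- The two-sided closed-form sandwich `d ≤ μ_NAW(ℤ^d) ≤ (d−1) + √((d−1)²+1)` (`d ≥ 2`). [folklore] -/
theorem nawConst_mem_Icc (hd : 2 ≤ d) :
    nawConst d ∈ Set.Icc (d : ℝ) ((d - 1 : ℝ) + Real.sqrt ((d - 1) ^ 2 + 1)) :=
  ⟨le_nawConst d, nawConst_le_nawFourConst hd⟩

/-- **On the square lattice the neighbour-avoiding constant is strictly below the self-avoiding one**:
`μ_NAW(ℤ²) ≤ 1 + √2 < 5/2 ≤ μ(ℤ²)` (the tree's certified `d + 1/2 ≤ μ(ℤ^d)`, `SAW.Zd.nat_add_half_le_connectiveConstant`). [folklore] -/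
theorem nawConst_two_lt_connectiveConstant_two : nawConst 2 < connectiveConstant 2 := by
  have h1 := nawConst_le_nawFourConst (d := 2) le_rfl
  have h2 := nat_add_half_le_connectiveConstant (d := 2) le_rfl
  have e : (((2 : ℕ) : ℝ) - 1) ^ 2 + 1 = 2 := by norm_num
  rw [e] at h1
  have hs : Real.sqrt 2 < 3 / 2 := by
    rw [Real.sqrt_lt' (by norm_num)]; norm_num
  push_cast at h1 h2
  linarith

end Summit.CriticalPhenomena.PercolationContinuityZ3.Theorems.Pcint.NawTail
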